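import Literature.AnabelianGeometry.AbsoluteAnabelian.HolomorphicEllipticCuspidalizationGenusOneHolds
import Literature.AnabelianGeometry.AbsoluteAnabelian.HolomorphicEllipticCuspidalizationTransportProofs
import Literature.AnabelianGeometry.AbsoluteAnabelian.HolomorphicEllipticCuspidalizationDeck
import Literature.AnabelianGeometry.AbsoluteAnabelian.HolomorphicEllipticCuspidalizationProofs
import Literature.AnabelianGeometry.AbsoluteAnabelian.HolomorphicCoresDeckProofs
import Literature.AnabelianGeometry.AbsoluteAnabelian.ArchimedeanHolFieldFunctorGeometricCovers
import Literature.Geometry.Kaehler.RiemannSurfaceStructurePullbackRigidity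
import Literature.Geometry.Kaehler.ComplexTorusHolomorphicMaps
import Literature.Geometry.Kaehler.ComplexTorusEvenEllipticFunctions
import Literature.Topology.CoveringSpaces.FiniteCoveringProper
import HarnessLib

/-!
# Finite étale holomorphic maps between once-punctured complex tori are biholomorphisms
# (Cor 2.7 (f) «functoriality with respect to finite étale morphisms» for the `𝔼`-data, PROOF-ONLY)

Topic `Literature/AnabelianGeometry/AbsoluteAnabelian`, sub-DAG [AbsTopIII] Cor. 2.7, item (f): «the
asserted “functoriality” is with respect to finite étale morphisms of Aut-holomorphic orbispaces arising
from hyperbolic orbicurves over `ℂ`» (p.60). For the once-punctured elliptic curves `𝔼` of item (a)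
(the model family `puncturedTorus Φ = ℂ/Φ(ℤ^ι) ∖ {0}` of `HolomorphicEllipticCuspidalization`), a finite
étale holomorphic map `f : 𝔼_{Φ′} → 𝔼_Φ` is automatically an ISOMORPHISM, so that (f) for the `𝔼`-data
reduces to the isomorphism case (c).5 (`image_cuspidalTorsionPoints_eq`, w5-d140) — this file proves
that reduction:

1. `continuous_extend` — `f` is PROPER (`IsCoveringMap.isProperMap_of_finite`), hence extends
   continuously across the punctures to `F : T_{Φ′} → T_Φ`, `F 0 = 0` (the compactifications, (c).6);
2. `mdifferentiable_extend` — `F` is holomorphic (removable singularity on a Riemann surface);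
3. `extend_add` — `F` is a HOMOMORPHISM (Lange–Birkenhake Prop. 1.1.6, the tree's
   `ComplexTorus.map_add_of_mdifferentiable`);
4. `extend_injective`, `extend_surjective` — kernel `F⁻¹(0) = {0}`, image an open subgroup of the
   connected `T_Φ`: `F` is an isomorphism of complex tori («isogeny ∘ translation after
   compactification», degree `1`, translation `0`), packaged as `exists_continuousAddEquiv_extension`;
5. **`bijective_of_isFiniteEtale`**, **`exists_homeomorph_of_isFiniteEtale`** — `f` is a BIHOLOMORPHISM;
6. **`image_cuspidalTorsionPoints_eq_of_isFiniteEtale`** (model family) and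
   **`image_cuspidalTorsionPoints_eq_of_isFiniteEtale_of_isPuncturedEllipticCurve`** (typed
   `IsPuncturedEllipticCurve`, via (c).4 `puncturedEllipticCurveModel_holds` and (c).5
   `image_cuspidalTorsionPoints_eq`): a finite étale holomorphic map of once-punctured elliptic curves
   carries the cuspidal torsion points ONTO the cuspidal torsion points — Cor 2.7 (f) for the `𝔼`-data
   (the orbispace part `X′ → X` goes through the hyperbolic core and is NOT treated here).

Classical content (Riemann–Hurwitz: `χ = −1 = d · (−1)` forces `d = 1`), proved via the torus group law.
Everything is a theorem; no definition, no named fact; MODEL-LEVEL for 1–5, typed hypothesis in 6.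
HONEST FRAMING: typed ≠ proved for the node; nothing here bears on the disputed [IUTchIII] Cor. 3.12.

## References

* S. Mochizuki, *Topics in Absolute Anabelian Geometry III* (2015), Cor. 2.7 (b)(c)(f) pp.59–60. [MochizukiAbsTopIII2015]
* H. Lange, Ch. Birkenhake, *Complex Abelian Varieties* (1992), Prop. 1.1.6. [LangeBirkenhake1992]
-/

noncomputable section

namespace Literature.AnabelianGeometry.AbsoluteAnabelian

open _root_.TopologicalSpace _root_.Topology _root_.Set _root_.Function _root_.Filter
open scoped _root_.Manifold _root_.ContDiff
open Literature.Geometry.Kaehler (ComplexTorus)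
open Literature.Geometry.Kaehler

namespace HolomorphicEllipticCuspidalization

section Model

variable {ι ι' : Type} [Fintype ι] [Fintype ι'] (Φ : (ι → ℝ) ≃L[ℝ] ℂ) (Φ' : (ι' → ℝ) ≃L[ℝ] ℂ)
  {f : puncturedTorus Φ' → puncturedTorus Φ}

/-! ### §1 Extension across the punctures -/

/-- Values of a map into the punctured torus are non-zero. [cite: MochizukiAbsTopIII2015, Corollary 2.7 (a) p.58] -/
theorem coe_apply_ne_zero (x : puncturedTorus Φ') : ((f x : puncturedTorus Φ) : ComplexTorus Φ) ≠ 0 :=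
  (f x).2

/-- The extension by `0 ↦ 0` of `f` agrees with `f` off `0`. [cite: MochizukiAbsTopIII2015, Corollary 2.7 (c) p.59] -/
theorem extend_apply_coe (x : puncturedTorus Φ') :
    Function.extend Subtype.val (fun x => ((f x : puncturedTorus Φ) : ComplexTorus Φ)) (fun _ => 0)
      (x : ComplexTorus Φ') = (f x : ComplexTorus Φ) :=
  Subtype.val_injective.extend_apply _ _ x

/-- The extension by `0 ↦ 0` of `f` sends `0` to `0`. [cite: MochizukiAbsTopIII2015, Corollary 2.7 (c) p.59] -/
theorem extend_apply_zero :
    Function.extend Subtype.val (fun x => ((f x : puncturedTorus Φ) : ComplexTorus Φ)) (fun _ => 0)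
      (0 : ComplexTorus Φ') = 0 := by
  rw [Function.extend_apply']
  rintro ⟨x, hx⟩
  exact x.2 hx

/-- The extension by `0 ↦ 0` of `f` vanishes ONLY at `0`. [cite: MochizukiAbsTopIII2015, Corollary 2.7 (c) p.59] -/
theorem extend_eq_zero_iff (t : ComplexTorus Φ') :
    Function.extend Subtype.val (fun x => ((f x : puncturedTorus Φ) : ComplexTorus Φ)) (fun _ => 0) t
      = 0 ↔ t = 0 := by
  refine ⟨fun h => ?_, fun h => by rw [h]; exact extend_apply_zero Φ Φ'⟩
  by_contra ht
  have := extend_apply_coe Φ Φ' (f := f) ⟨t, ht⟩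
  rw [h] at this
  exact coe_apply_ne_zero Φ Φ' ⟨t, ht⟩ this.symm

/-- **Continuous extension across the punctures**: a finite étale map `f : 𝔼_{Φ′} → 𝔼_Φ` of punctured
tori is proper (`IsCoveringMap.isProperMap_of_finite`), so its extension by `0 ↦ 0` to the tori — the
one-point compactifications, (c).6 — is continuous. [cite: MochizukiAbsTopIII2015, Corollary 2.7 (c) p.59] -/
theorem continuous_extend (hf : IsFiniteEtale f) :
    Continuous (Function.extend Subtype.val (fun x => ((f x : puncturedTorus Φ) : ComplexTorus Φ))
      (fun _ => 0)) := by
  set F := Function.extend Subtype.val (fun x => ((f x : puncturedTorus Φ) : ComplexTorus Φ))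
    (fun _ => 0) with hF
  have hprop : IsProperMap f :=
    Literature.Topology.CoveringSpaces.IsCoveringMap.isProperMap_of_finite hf.isCoveringMap
      hf.finite_fibre
  have hF0 : F 0 = 0 := extend_apply_zero Φ Φ'
  have hFx : ∀ x : puncturedTorus Φ', F (x : ComplexTorus Φ') = (f x : ComplexTorus Φ) :=
    fun x => extend_apply_coe Φ Φ' x
  rw [continuous_iff_continuousAt]
  intro t
  by_cases ht : t = 0
  · -- at the puncture: preimages of compact sets avoiding `0` are compact, hence closed
    subst ht
    rw [ContinuousAt, hF0]
    refine tendsto_nhds.2 fun V hV hV0 => ?_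
    -- `K = Vᶜ` is compact and misses `0`, so lies in the punctured torus
    have hK : IsCompact (Vᶜ : Set (ComplexTorus Φ)) := hV.isClosed_compl.isCompact
    set KE : Set (puncturedTorus Φ) := Subtype.val ⁻¹' Vᶜ with hKE
    have hKEc : IsCompact KE := by
      rw [IsEmbedding.subtypeVal.isCompact_iff]
      have : Subtype.val '' KE = (Vᶜ : Set (ComplexTorus Φ)) := by
        rw [hKE, Set.image_preimage_eq_inter_range]
        refine Set.inter_eq_left.2 fun y hy => ⟨⟨y, fun h => hy ?_⟩, rfl⟩
        have : y = 0 := h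
        rw [this]; exact hV0
      rw [this]
      exact hK
    have hC : IsCompact (Subtype.val '' (f ⁻¹' KE) : Set (ComplexTorus Φ')) :=
      (hprop.isCompact_preimage hKEc).image continuous_subtype_val
    have hCcl : IsClosed (Subtype.val '' (f ⁻¹' KE) : Set (ComplexTorus Φ')) := hC.isClosed
    have h0C : (0 : ComplexTorus Φ') ∉ (Subtype.val '' (f ⁻¹' KE) : Set (ComplexTorus Φ')) := by
      rintro ⟨x, -, hx⟩
      exact x.2 hx
    filter_upwards [hCcl.isOpen_compl.mem_nhds h0C] with s hs
    by_contra hsV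
    by_cases hs0 : s = 0
    · subst hs0
      exact hsV (show (0 : ComplexTorus Φ') ∈ F ⁻¹' V by rw [Set.mem_preimage, hF0]; exact hV0)
    · apply hs
      refine ⟨⟨s, hs0⟩, ?_, rfl⟩
      show ((f ⟨s, hs0⟩ : puncturedTorus Φ) : ComplexTorus Φ) ∈ Vᶜ
      rw [← hFx ⟨s, hs0⟩]
      exact hsV
  · -- off the puncture `F` is `f` read in the torus
    have hopen : IsOpen ({0}ᶜ : Set (ComplexTorus Φ')) := isOpen_compl_singleton
    have hcont : ContinuousOn F {0}ᶜ := by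
      rw [continuousOn_iff_continuous_restrict]
      have : ({0}ᶜ : Set (ComplexTorus Φ')).restrict F =
          fun x : ({0}ᶜ : Set (ComplexTorus Φ')) => ((f ⟨x, x.2⟩ : puncturedTorus Φ) : ComplexTorus Φ) := by
        funext x
        exact hFx ⟨x, x.2⟩
      rw [this]
      exact continuous_subtype_val.comp (hf.isCoveringMap.continuous.comp (by fun_prop))
    exact hcont.continuousAt (hopen.mem_nhds ht)

/-! ### §2 The extension is a holomorphic homomorphism of complex tori -/

/-- Off the puncture the extension is holomorphic where `f` is. [cite: MochizukiAbsTopIII2015, Corollary 2.7 (c) p.59] -/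
theorem mdifferentiableAt_extend_coe
    (df : MDifferentiable 𝓘(ℂ, ℂ) 𝓘(ℂ, ℂ) f) (x : puncturedTorus Φ') :
    MDifferentiableAt 𝓘(ℂ, ℂ) 𝓘(ℂ, ℂ)
      (Function.extend Subtype.val (fun x => ((f x : puncturedTorus Φ) : ComplexTorus Φ)) (fun _ => 0))
      (x : ComplexTorus Φ') := by
  rw [← mdifferentiableAt_subtype_iff (U := puncturedTorus Φ') (x := x)]
  have : (fun y : puncturedTorus Φ' =>
      Function.extend Subtype.val (fun x => ((f x : puncturedTorus Φ) : ComplexTorus Φ)) (fun _ => 0)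
        (y : ComplexTorus Φ')) = Subtype.val ∘ f :=
    funext fun y => extend_apply_coe Φ Φ' y
  rw [this, mdifferentiableAt_subtypeVal_comp_iff]
  exact df x

/-- **The extension is holomorphic** on the whole torus: holomorphic off `0` and continuous at `0`
(Riemann's removable singularity theorem on a Riemann surface). [cite: MochizukiAbsTopIII2015, Corollary 2.7 (c) p.59] -/
theorem mdifferentiable_extend (hf : IsFiniteEtale f) (df : MDifferentiable 𝓘(ℂ, ℂ) 𝓘(ℂ, ℂ) f) :
    MDifferentiable 𝓘(ℂ, ℂ) 𝓘(ℂ, ℂ)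
      (Function.extend Subtype.val (fun x => ((f x : puncturedTorus Φ) : ComplexTorus Φ))
        (fun _ => 0)) := by
  intro t
  by_cases ht : t = 0
  · subst ht
    refine RiemannSurface.mdifferentiableAt_of_continuousAt (continuous_extend Φ Φ' hf).continuousAt ?_
    filter_upwards [self_mem_nhdsWithin] with s hs
    exact mdifferentiableAt_extend_coe Φ Φ' df ⟨s, hs⟩
  · exact mdifferentiableAt_extend_coe Φ Φ' df ⟨t, ht⟩

/-- **The extension is a homomorphism** `T_{Φ′} → T_Φ` (Lange–Birkenhake Prop. 1.1.6: a holomorphic map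
of complex tori with `F 0 = 0` is additive — «isogeny after compactification»).
[cite: LangeBirkenhake1992, Proposition 1.1.6] -/
theorem extend_add (hf : IsFiniteEtale f) (df : MDifferentiable 𝓘(ℂ, ℂ) 𝓘(ℂ, ℂ) f)
    (s t : ComplexTorus Φ') :
    Function.extend Subtype.val (fun x => ((f x : puncturedTorus Φ) : ComplexTorus Φ)) (fun _ => 0)
        (s + t) =
      Function.extend Subtype.val (fun x => ((f x : puncturedTorus Φ) : ComplexTorus Φ)) (fun _ => 0) s +
        Function.extend Subtype.val (fun x => ((f x : puncturedTorus Φ) : ComplexTorus Φ)) (fun _ => 0)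
          t :=
  ComplexTorus.map_add_of_mdifferentiable (mdifferentiable_extend Φ Φ' hf df) (extend_apply_zero Φ Φ')
    s t

/-- **The extension is injective**: an additive map with kernel `F⁻¹(0) = {0}`.
[cite: MochizukiAbsTopIII2015, Corollary 2.7 (c) p.59] -/
theorem extend_injective (hf : IsFiniteEtale f) (df : MDifferentiable 𝓘(ℂ, ℂ) 𝓘(ℂ, ℂ) f) :
    Function.Injective (Function.extend Subtype.val
      (fun x => ((f x : puncturedTorus Φ) : ComplexTorus Φ)) (fun _ => 0)) := by
  set F := Function.extend Subtype.val (fun x => ((f x : puncturedTorus Φ) : ComplexTorus Φ))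
    (fun _ => 0) with hF
  let Fh : ComplexTorus Φ' →+ ComplexTorus Φ :=
    AddMonoidHom.mk' F (extend_add Φ Φ' hf df)
  intro s t hst
  have h0 : F (s - t) = 0 := by
    show Fh (s - t) = 0
    rw [map_sub, sub_eq_zero]
    exact hst
  exact sub_eq_zero.1 ((extend_eq_zero_iff Φ Φ' (s - t)).1 h0)

/-- **The extension is surjective**: its image is a subgroup of the connected torus `T_Φ` containing the
non-empty open set `f(𝔼_{Φ′})` (a covering map is open), hence an open — so closed — subgroup.
[cite: MochizukiAbsTopIII2015, Corollary 2.7 (c) p.59] -/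
theorem extend_surjective (hf : IsFiniteEtale f) (df : MDifferentiable 𝓘(ℂ, ℂ) 𝓘(ℂ, ℂ) f) :
    Function.Surjective (Function.extend Subtype.val
      (fun x => ((f x : puncturedTorus Φ) : ComplexTorus Φ)) (fun _ => 0)) := by
  set F := Function.extend Subtype.val (fun x => ((f x : puncturedTorus Φ) : ComplexTorus Φ))
    (fun _ => 0) with hF
  let Fh : ComplexTorus Φ' →+ ComplexTorus Φ :=
    AddMonoidHom.mk' F (extend_add Φ Φ' hf df)
  -- a point of the punctured source torus
  obtain ⟨s₀, hs₀⟩ : ({0}ᶜ : Set (ComplexTorus Φ')).Nonempty :=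
    (isPathConnected_compl_of_finite Φ' (Set.finite_singleton 0)).nonempty
  -- the image `f(𝔼′)`, read in `T_Φ`, is open and lies in the range of `F`
  have hUopen : IsOpen (Subtype.val '' Set.range f : Set (ComplexTorus Φ)) :=
    (puncturedTorus Φ).isOpen.isOpenEmbedding_subtypeVal.isOpenMap _
      hf.isCoveringMap.isLocalHomeomorph.isOpenMap.isOpen_range
  have hUsub : (Subtype.val '' Set.range f : Set (ComplexTorus Φ)) ⊆ (Fh.range : Set (ComplexTorus Φ)) := by
    rintro _ ⟨_, ⟨x, rfl⟩, rfl⟩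
    exact ⟨(x : ComplexTorus Φ'), extend_apply_coe Φ Φ' x⟩
  have hmem : (Fh.range : Set (ComplexTorus Φ)) ∈ 𝓝 (F s₀) :=
    Filter.mem_of_superset (hUopen.mem_nhds ⟨f ⟨s₀, hs₀⟩, ⟨⟨s₀, hs₀⟩, rfl⟩,
      (extend_apply_coe Φ Φ' (f := f) ⟨s₀, hs₀⟩).symm⟩) hUsub
  have hopen : IsOpen (Fh.range : Set (ComplexTorus Φ)) := Fh.range.isOpen_of_mem_nhds hmem
  have hclopen : IsClopen (Fh.range : Set (ComplexTorus Φ)) := ⟨Fh.range.isClosed_of_isOpen hopen, hopen⟩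
  have huniv : (Fh.range : Set (ComplexTorus Φ)) = Set.univ :=
    hclopen.eq_univ ⟨0, Fh.range.zero_mem⟩
  intro y
  have hy : y ∈ (Fh.range : Set (ComplexTorus Φ)) := by rw [huniv]; trivial
  obtain ⟨x, hx⟩ := hy
  exact ⟨x, hx⟩

/-- **The extension is an isomorphism of complex tori**: a holomorphic, additive homeomorphism
`T_{Φ′} ≃ₜ+ T_Φ` extending `f` and sending `0` to `0` («isogeny ∘ translation after compactification», the
isogeny of degree `1`). [cite: LangeBirkenhake1992, Proposition 1.1.6]
[cite: MochizukiAbsTopIII2015, Corollary 2.7 (c) p.59] -/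
theorem exists_continuousAddEquiv_extension (hf : IsFiniteEtale f)
    (df : MDifferentiable 𝓘(ℂ, ℂ) 𝓘(ℂ, ℂ) f) :
    ∃ Γ : ComplexTorus Φ' ≃ₜ+ ComplexTorus Φ, MDifferentiable 𝓘(ℂ, ℂ) 𝓘(ℂ, ℂ) Γ ∧
      (∀ x : puncturedTorus Φ', Γ x = (f x : ComplexTorus Φ)) ∧ Γ 0 = 0 := by
  set F := Function.extend Subtype.val (fun x => ((f x : puncturedTorus Φ) : ComplexTorus Φ))
    (fun _ => 0) with hF
  have hbij : Function.Bijective F := ⟨extend_injective Φ Φ' hf df, extend_surjective Φ Φ' hf df⟩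
  let e : ComplexTorus Φ' ≃ₜ ComplexTorus Φ :=
    (continuous_extend Φ Φ' hf).homeoOfEquivCompactToT2 (f := Equiv.ofBijective F hbij)
  refine ⟨{ e with map_add' := fun x y => extend_add Φ Φ' hf df x y },
    mdifferentiable_extend Φ Φ' hf df,
    fun x => extend_apply_coe Φ Φ' x, extend_apply_zero Φ Φ'⟩

/-! ### §3 The finite étale map itself is a biholomorphism (degree `1`) -/

/-- **A finite étale holomorphic map of once-punctured complex tori is bijective** (degree `1`):
Riemann–Hurwitz for unramified maps of once-punctured tori, here via the torus structure.
[cite: MochizukiAbsTopIII2015, Corollary 2.7 (f) p.60] -/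
theorem bijective_of_isFiniteEtale (hf : IsFiniteEtale f) (df : MDifferentiable 𝓘(ℂ, ℂ) 𝓘(ℂ, ℂ) f) :
    Function.Bijective f := by
  refine ⟨fun x y hxy => ?_, fun y => ?_⟩
  · have h := extend_injective Φ Φ' hf df (a₁ := (x : ComplexTorus Φ')) (a₂ := (y : ComplexTorus Φ'))
    apply Subtype.ext
    apply h
    rw [extend_apply_coe Φ Φ' x, extend_apply_coe Φ Φ' y, hxy]
  · obtain ⟨t, ht⟩ := extend_surjective Φ Φ' hf df (y : ComplexTorus Φ)
    have ht0 : t ≠ 0 := by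
      rintro rfl
      rw [extend_apply_zero Φ Φ'] at ht
      exact y.2 ht.symm
    refine ⟨⟨t, ht0⟩, Subtype.ext ?_⟩
    rw [← ht, extend_apply_coe Φ Φ' (f := f) ⟨t, ht0⟩]

/-- **A finite étale holomorphic map of once-punctured complex tori is a homeomorphism.**
[cite: MochizukiAbsTopIII2015, Corollary 2.7 (f) p.60] -/
theorem isHomeomorph_of_isFiniteEtale (hf : IsFiniteEtale f)
    (df : MDifferentiable 𝓘(ℂ, ℂ) 𝓘(ℂ, ℂ) f) : IsHomeomorph f :=
  ⟨hf.isCoveringMap.continuous, hf.isCoveringMap.isLocalHomeomorph.isOpenMap,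
    bijective_of_isFiniteEtale Φ Φ' hf df⟩

/-- **A finite étale holomorphic map of once-punctured complex tori is a BIHOLOMORPHISM**: it is a
homeomorphism `e` with `e` and `e⁻¹` holomorphic (the inverse by rigidity of local biholomorphisms).
[cite: MochizukiAbsTopIII2015, Corollary 2.7 (f) p.60] -/
theorem exists_homeomorph_of_isFiniteEtale (hf : IsFiniteEtale f)
    (df : MDifferentiable 𝓘(ℂ, ℂ) 𝓘(ℂ, ℂ) f) :
    ∃ e : puncturedTorus Φ' ≃ₜ puncturedTorus Φ, ⇑e = f ∧ MDifferentiable 𝓘(ℂ, ℂ) 𝓘(ℂ, ℂ) e ∧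
      MDifferentiable 𝓘(ℂ, ℂ) 𝓘(ℂ, ℂ) e.symm := by
  let e : puncturedTorus Φ' ≃ₜ puncturedTorus Φ := (isHomeomorph_of_isFiniteEtale Φ Φ' hf df).homeomorph f
  have he : ⇑e = f := rfl
  have hp : IsLocalDiffeomorph 𝓘(ℂ, ℂ) 𝓘(ℂ, ℂ) ω f :=
    isLocalDiffeomorph_of_mdifferentiable_of_isLocalHomeomorph df hf.isCoveringMap.isLocalHomeomorph
  have hq : IsLocalDiffeomorph 𝓘(ℂ, ℂ) 𝓘(ℂ, ℂ) ω (id : puncturedTorus Φ → puncturedTorus Φ) :=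
    (Diffeomorph.refl 𝓘(ℂ, ℂ) (puncturedTorus Φ) ω).isLocalDiffeomorph
  let D := diffeomorphOfHomeomorphOver (p := f) (q := id) e hp hq (by rw [he]; rfl)
  refine ⟨e, he, he ▸ df, ?_⟩
  have : ⇑e.symm = ⇑D.symm := by
    funext y
    apply e.injective
    rw [e.apply_symm_apply]
    have h1 : D (D.symm y) = y := D.apply_symm_apply y
    have h2 : ⇑D = ⇑e := diffeomorphOfHomeomorphOver_coe e hp hq _
    rw [h2] at h1
    exact h1.symm
  rw [this]
  exact D.symm.contMDiff.mdifferentiable (by simp)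

/-- **Cor 2.7 (f) for the `𝔼`-data at the model family**: a finite étale holomorphic map
`f : 𝔼_{Φ′} → 𝔼_Φ` of once-punctured complex tori carries the cuspidal torsion points ONTO the cuspidal
torsion points (it is a biholomorphism, and (c).5 `image_cuspidalTorsionPoints_eq` applies).
[cite: MochizukiAbsTopIII2015, Corollary 2.7 (f) p.60] -/
theorem image_cuspidalTorsionPoints_eq_of_isFiniteEtale (hf : IsFiniteEtale f)
    (df : MDifferentiable 𝓘(ℂ, ℂ) 𝓘(ℂ, ℂ) f) :
    f '' cuspidalTorsionPoints (puncturedTorus Φ') = cuspidalTorsionPoints (puncturedTorus Φ) := by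
  obtain ⟨e, he, he₁, he₂⟩ := exists_homeomorph_of_isFiniteEtale Φ Φ' hf df
  rw [← he]
  exact image_cuspidalTorsionPoints_eq e he₁ he₂

end Model

/-! ### §4 Cor 2.7 (f) for once-punctured elliptic curves in the typed sense -/

section Typed

variable {E : Type} [TopologicalSpace E] [T2Space E] [ChartedSpace ℂ E] [IsManifold 𝓘(ℂ, ℂ) ω E]
  {E' : Type} [TopologicalSpace E'] [T2Space E'] [ChartedSpace ℂ E'] [IsManifold 𝓘(ℂ, ℂ) ω E']
  {g : E → E'}

/-- **A finite étale holomorphic map between once-punctured elliptic curves is a biholomorphism**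
(typed hypothesis `IsPuncturedEllipticCurve` of Cor 2.7; via (c).4 `puncturedEllipticCurveModel_holds`
both curves are model punctured tori, and `exists_homeomorph_of_isFiniteEtale` applies to the transported
map). [cite: MochizukiAbsTopIII2015, Corollary 2.7 (f) p.60] -/
theorem exists_homeomorph_of_isFiniteEtale_of_isPuncturedEllipticCurve
    (hE : TorsionPointsDenseUniqueGroupLaw.IsPuncturedEllipticCurve E)
    (hE' : TorsionPointsDenseUniqueGroupLaw.IsPuncturedEllipticCurve E')
    (hg : IsFiniteEtale g) (dg : MDifferentiable 𝓘(ℂ, ℂ) 𝓘(ℂ, ℂ) g) :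
    ∃ e : E ≃ₜ E', ⇑e = g ∧ MDifferentiable 𝓘(ℂ, ℂ) 𝓘(ℂ, ℂ) e ∧
      MDifferentiable 𝓘(ℂ, ℂ) 𝓘(ℂ, ℂ) e.symm := by
  obtain ⟨Φ', e₁, he₁, he₁'⟩ := puncturedEllipticCurveModel_holds E hE
  obtain ⟨Φ, e₂, he₂, he₂'⟩ := puncturedEllipticCurveModel_holds E' hE'
  -- the transported map of model punctured tori
  set f : puncturedTorus Φ' → puncturedTorus Φ := e₂ ∘ g ∘ e₁.symm with hf_def
  have hf : IsFiniteEtale f := by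
    refine ⟨(hg.isCoveringMap.comp_homeomorph e₁.symm).homeomorph_comp e₂, fun y => ?_⟩
    have : f ⁻¹' {y} = e₁.symm ⁻¹' (g ⁻¹' {e₂.symm y}) := by
      ext x
      simp only [hf_def, Set.mem_preimage, comp_apply, Set.mem_singleton_iff]
      rw [← e₂.apply_symm_apply y, e₂.injective.eq_iff, e₂.apply_symm_apply]
    rw [this]
    exact (hg.finite_fibre _).preimage e₁.symm.injective.injOn
  have df : MDifferentiable 𝓘(ℂ, ℂ) 𝓘(ℂ, ℂ) f := he₂.comp (dg.comp he₁')
  obtain ⟨e, he, de, de'⟩ := exists_homeomorph_of_isFiniteEtale Φ Φ' hf df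
  refine ⟨e₁.trans (e.trans e₂.symm), ?_, ?_, ?_⟩
  · funext x
    simp only [Homeomorph.trans_apply, he, hf_def, comp_apply, Homeomorph.symm_apply_apply]
  · exact he₂'.comp (de.comp he₁)
  · exact he₁'.comp (de'.comp he₂)

/-- **Cor 2.7 (f), «functoriality with respect to finite étale morphisms», for the `𝔼`-data IN FULL**:
a finite étale holomorphic map `g : E → E′` of once-punctured elliptic curves (typed
`IsPuncturedEllipticCurve`) carries the cuspidal torsion points of `E` ONTO those of `E′` — it is a
biholomorphism, to which (c).5 `image_cuspidalTorsionPoints_eq` applies.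
[cite: MochizukiAbsTopIII2015, Corollary 2.7 (f) p.60] -/
theorem image_cuspidalTorsionPoints_eq_of_isFiniteEtale_of_isPuncturedEllipticCurve
    (hE : TorsionPointsDenseUniqueGroupLaw.IsPuncturedEllipticCurve E)
    (hE' : TorsionPointsDenseUniqueGroupLaw.IsPuncturedEllipticCurve E')
    (hg : IsFiniteEtale g) (dg : MDifferentiable 𝓘(ℂ, ℂ) 𝓘(ℂ, ℂ) g) :
    g '' cuspidalTorsionPoints E = cuspidalTorsionPoints E' := by
  obtain ⟨e, he, he₁, he₂⟩ := exists_homeomorph_of_isFiniteEtale_of_isPuncturedEllipticCurve hE hE' hg dg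
  rw [← he]
  exact image_cuspidalTorsionPoints_eq e he₁ he₂

/-- **Degree `1` in the typed sense**: a finite étale holomorphic map of once-punctured elliptic curves
is a bijection. [cite: MochizukiAbsTopIII2015, Corollary 2.7 (f) p.60] -/
theorem bijective_of_isFiniteEtale_of_isPuncturedEllipticCurve
    (hE : TorsionPointsDenseUniqueGroupLaw.IsPuncturedEllipticCurve E)
    (hE' : TorsionPointsDenseUniqueGroupLaw.IsPuncturedEllipticCurve E')
    (hg : IsFiniteEtale g) (dg : MDifferentiable 𝓘(ℂ, ℂ) 𝓘(ℂ, ℂ) g) : Function.Bijective g := by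
  obtain ⟨e, he, -, -⟩ := exists_homeomorph_of_isFiniteEtale_of_isPuncturedEllipticCurve hE hE' hg dg
  rw [← he]
  exact e.bijective

end Typed

end HolomorphicEllipticCuspidalization

end Literature.AnabelianGeometry.AbsoluteAnabelian
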